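import Summits.QuantumFields.GaugeBoot.BootstrapBoundsConvergenceZd
import HarnessLib

/-!
# Certificates of the translation-reduced bootstrap on `ℤ^d`: SOS ⊕ loop equations ⊕ translation multipliers — sound and complete for the homogeneous phases (gauge-boot, L1/L4 supplement)

HONEST FRAMING (cell `pub-gaugeboot`, page 1 of every file): the venture produces certified bounds
on lattice expectations at stated coupling, gauge group, dimension and torus size; NOT a mass gap,
NOT a continuum limit, NOT a string tension; NOT Yang–Mills-summit-bearing (barriers
`FixedCouplingUltralocality`, `PerturbativeInvisibility`). Structural; it certifies no number.

## Content (`SU(N)` on `ℤ^d`, any real `β`, word level `n`)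

The dual of the translation-reduced SDP `symLevelValuesZdSuN` (`BootstrapTranslationReductionZd`):
a REDUCED CERTIFICATE for `P ≤ c` at level `n` is an identity
`c • 1 - P = Σ_j v_j² + Σ_l λ_l (f_l' - β f_l S_l') + Σ_m κ_m (w_m ∘ τ_{a_m} - w_m)` — sums of squares
of level-`n` test functions, level-`n` loop equations, and TRANSLATION MULTIPLIERS on words of
length `≤ 2n` (in the reduced SDP the last term is invisible: `w ∘ τ_a` and `w` are the same variable).

* `translationDiffZdSuN N n` (span of `w ∘ τ_a - w`, `w` of length `≤ 2n`), ★ `symCertConeZdSuN N β n`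
  (= `certConeZdSuN ⊔ translationDiff`); both inside the level-`n` certificate domain, on which `1`
  stays an order unit;
* ★ `isDualFeasible_symCertCone_iff_suN` — dual feasibility for the reduced cone IS reduced
  feasibility (level-`n` feasible + translation invariant on the words of length `≤ 2n`);
* ★★ SOUNDNESS `le_of_mem_symCertCone_suN`, `invDlr_integral_le_of_mem_symCertCone_suN` — a
  reduced certificate bounds every reduced-feasible value and every TRANSLATION-INVARIANT Gibbs state
  (it need not bound a non-invariant one);
* ★★★ NO DUALITY GAP `forall_symLevelValuesZd_le_iff_suN`, `exists_symCertificate_suN` (explicit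
  `σ + ρ + δ` decomposition of `c' • 1 - P` for every `c'` above the reduced level-`n` maximum),
  `sSup_symLevelValuesZd_eq_sInf_suN`;
* ★★★ COMPLETENESS FOR THE HOMOGENEOUS PHASES `exists_symCertificate_of_forall_invDlr_le_suN` — if
  `∫ P dμ ≤ c₀` for every translation-invariant Gibbs state and `c₀ < c`, then SOME level has a
  reduced certificate of `c • 1 - P` (via `tendsto_sSup_symLevelValuesZd_suN`). Compare
  `exists_certificate_of_forall_dlr_le_suN`: plain certificates prove exactly the bounds valid in
  ALL Gibbs states; reduced certificates prove exactly the bounds valid in the HOMOGENEOUS ones.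

What this is NOT: sizes / levels of the certificates; whether translation multipliers ever
certify a bound strictly below the plain optimum at the same level; rates.

References: P. Anderson, M. Kruczenski, Nucl. Phys. B 921 (2017); V. Kazakov, Z. Zheng,
arXiv:2203.11360, arXiv:2404.16925 (dual bounds of the reduced SDP); C. Josz, D. Henrion, Optim.
Lett. 10 (2016) 3. Folklore.
-/

noncomputable section

open MeasureTheory Filter Topology NormedSpace
open Literature.MathematicalPhysics.QuantumFieldTheory (LatticeRep)
open Literature.MathematicalPhysics.QuantumLattice

namespace Summit.QuantumFields.GaugeBoot

open OrderUnitDuality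

section ZdSuN

variable {d : ℕ} (N : ℕ) (β : ℝ)

/-- **The translation multipliers' space**: the span of the differences `w ∘ τ_a - w`, `w` a
combination of words of length `≤ 2n`, `a ∈ ℤ^d`. [folklore] -/
def translationDiffZdSuN (n : ℕ) :
    Submodule ℝ C(LGConfig d (Matrix.specialUnitaryGroup (Fin N) ℂ), ℝ) :=
  Submodule.span ℝ {x | ∃ (a : Fin d → ℤ) (w : C(LGConfig d (Matrix.specialUnitaryGroup (Fin N) ℂ), ℝ)),
    w ∈ wordTruncation (ι := ZdEdge d) (fundamentalLatticeRep N) (n + n) ∧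
      w.comp (relabelCM (G := Matrix.specialUnitaryGroup (Fin N) ℂ) (edgeShift a)) - w = x}

/-- ★ **The reduced certificate cone**: SOS of level-`n` test functions + level-`n` rows +
translation multipliers. [folklore] -/
def symCertConeZdSuN (n : ℕ) :
    PointedCone ℝ C(LGConfig d (Matrix.specialUnitaryGroup (Fin N) ℂ), ℝ) :=
  certConeZdSuN (d := d) N β n ⊔ (translationDiffZdSuN (d := d) N n).restrictScalars {c : ℝ // 0 ≤ c}

/-- The plain certificate cone sits inside the reduced one. -/
theorem certCone_le_symCertCone_suN (n : ℕ) :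
    certConeZdSuN (d := d) N β n ≤ symCertConeZdSuN (d := d) N β n := le_sup_left

/-- Translation differences are reduced certificates (of `0`). -/
theorem mem_symCertCone_of_mem_translationDiff_suN {n : ℕ}
    {x : C(LGConfig d (Matrix.specialUnitaryGroup (Fin N) ℂ), ℝ)} (hx : x ∈ translationDiffZdSuN (d := d) N n) :
    x ∈ symCertConeZdSuN (d := d) N β n :=
  Submodule.mem_sup_right hx

/-- The translation multipliers' space lies in the words of length `≤ 2n`. -/
theorem translationDiff_le_wordTruncation_suN (n : ℕ) :
    ∀ x ∈ translationDiffZdSuN (d := d) N n, x ∈ wordTruncation (ι := ZdEdge d) (fundamentalLatticeRep N) (n + n) := by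
  intro x hx
  induction hx using Submodule.span_induction with
  | mem y hy =>
    obtain ⟨a, w, hw, rfl⟩ := hy
    exact (Submodule.span ℝ _).sub_mem (comp_relabelCM_edgeShift_mem_wordTruncation _ _ a hw) hw
  | zero => exact (Submodule.span ℝ _).zero_mem
  | add y z _ _ hy hz => exact (Submodule.span ℝ _).add_mem hy hz
  | smul c y _ hy => exact (Submodule.span ℝ _).smul_mem c hy

/-- **The reduced cone lives in the level-`n` certificate domain.** -/
theorem symCertCone_le_certDomain_suN (n : ℕ) :
    ∀ x ∈ symCertConeZdSuN (d := d) N β n, x ∈ certDomainZdSuN (d := d) N β n := by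
  intro x hx
  obtain ⟨y, hy, z, hz, rfl⟩ := Submodule.mem_sup.1 hx
  exact (certDomainZdSuN (d := d) N β n).add_mem (certCone_le_certDomain _ n y hy)
    (mem_certDomain_of_mem_wordTruncation _ (translationDiff_le_wordTruncation_suN N n z hz))

/-- `1` is a reduced certificate and an order unit for the reduced cone on the certificate domain. -/
theorem symCertCone_orderUnit_suN (n : ℕ) :
    (1 : C(LGConfig d (Matrix.specialUnitaryGroup (Fin N) ℂ), ℝ)) ∈ symCertConeZdSuN (d := d) N β n ∧
      ∀ x ∈ certDomainZdSuN (d := d) N β n, ∃ t : ℝ,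
        t • (1 : C(LGConfig d (Matrix.specialUnitaryGroup (Fin N) ℂ), ℝ)) - x ∈ symCertConeZdSuN (d := d) N β n :=
  ⟨certCone_le_symCertCone_suN N β n (one_mem_certCone_words _ n), fun x hx => by
    obtain ⟨t, ht⟩ := (exists_smul_one_sub_mem_certCone (fundamentalLatticeRep N) hx).1
    exact ⟨t, certCone_le_symCertCone_suN N β n ht⟩⟩

/-! ### Dual feasibility for the reduced cone = reduced feasibility -/

/-- A functional translation invariant on the words of length `≤ 2n` kills the translation
multipliers' space. -/
theorem apply_eq_zero_of_mem_translationDiff_suN {n : ℕ}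
    {φ : C(LGConfig d (Matrix.specialUnitaryGroup (Fin N) ℂ), ℝ) →ₗ[ℝ] ℝ}
    (hinv : ∀ (a : Fin d → ℤ), ∀ w ∈ wordTruncation (ι := ZdEdge d) (fundamentalLatticeRep N) (n + n),
      φ (w.comp (relabelCM (G := Matrix.specialUnitaryGroup (Fin N) ℂ) (edgeShift a))) = φ w)
    {z : C(LGConfig d (Matrix.specialUnitaryGroup (Fin N) ℂ), ℝ)} (hz : z ∈ translationDiffZdSuN (d := d) N n) :
    φ z = 0 := by
  induction hz using Submodule.span_induction with
  | mem u hu =>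
    obtain ⟨a, w, hw, rfl⟩ := hu
    rw [map_sub, hinv a w hw, sub_self]
  | zero => exact map_zero φ
  | add u u' _ _ hu hu' => rw [map_add, hu, hu', add_zero]
  | smul c u _ hu => rw [map_smul, hu, smul_zero]

/-- ★ **Dual feasibility for the reduced cone is exactly reduced feasibility**: non-negative on the
reduced cone and normalised ⟺ level-`n` feasible and translation invariant on the words of length
`≤ 2n`. [folklore] -/
theorem isDualFeasible_symCertCone_iff_suN {n : ℕ}
    {φ : C(LGConfig d (Matrix.specialUnitaryGroup (Fin N) ℂ), ℝ) →ₗ[ℝ] ℝ} :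
    IsDualFeasible (symCertConeZdSuN (d := d) N β n) 1 φ ↔
      IsBootstrapFeasible (fundamentalLatticeRep N) (suExp N)
          (fun e => wilsonBoundaryAction (fundamentalRep (Fin N)) {e}) β
          (wordTruncation (ι := ZdEdge d) (fundamentalLatticeRep N) n) φ ∧
        ∀ (a : Fin d → ℤ), ∀ w ∈ wordTruncation (ι := ZdEdge d) (fundamentalLatticeRep N) (n + n),
          φ (w.comp (relabelCM (G := Matrix.specialUnitaryGroup (Fin N) ℂ) (edgeShift a))) = φ w := by
  constructor
  · rintro ⟨hpos, h1⟩
    refine ⟨isBootstrapFeasible_of_isDualFeasible (fundamentalLatticeRep N)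
      (wilsonBoundaryAction_polyDeriv_suN N)
      ⟨fun x hx => hpos x (certCone_le_symCertCone_suN N β n hx), h1⟩, fun a w hw => ?_⟩
    have hmem : w.comp (relabelCM (G := Matrix.specialUnitaryGroup (Fin N) ℂ) (edgeShift a)) - w ∈
        translationDiffZdSuN (d := d) N n := Submodule.subset_span ⟨a, w, hw, rfl⟩
    have h₁ := hpos _ (mem_symCertCone_of_mem_translationDiff_suN N β hmem)
    have h₂ := hpos _ (mem_symCertCone_of_mem_translationDiff_suN N β ((translationDiffZdSuN N n).neg_mem hmem))
    rw [map_neg] at h₂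
    rw [map_sub] at h₁ h₂
    linarith
  · rintro ⟨hφ, hinv⟩
    refine ⟨fun x hx => ?_, hφ.1⟩
    obtain ⟨y, hy, z, hz, rfl⟩ := Submodule.mem_sup.1 hx
    rw [Submodule.restrictScalars_mem] at hz
    rw [map_add, apply_eq_zero_of_mem_translationDiff_suN N hinv hz, add_zero]
    exact (hφ.isDualFeasible (fundamentalLatticeRep N)).1 y hy

/-- The reduced values as the values of the dual-feasible functionals of the reduced cone. -/
theorem symLevelValuesZd_eq_setOf_isDualFeasible_suN (n : ℕ)
    (P : C(LGConfig d (Matrix.specialUnitaryGroup (Fin N) ℂ), ℝ)) :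
    symLevelValuesZdSuN (d := d) N β n P =
      {t | ∃ φ : C(LGConfig d (Matrix.specialUnitaryGroup (Fin N) ℂ), ℝ) →ₗ[ℝ] ℝ,
        IsDualFeasible (symCertConeZdSuN (d := d) N β n) 1 φ ∧ φ P = t} := by
  ext t
  constructor
  · rintro ⟨φ, hφ, hinv, rfl⟩
    exact ⟨φ, (isDualFeasible_symCertCone_iff_suN N β).2 ⟨hφ, hinv⟩, rfl⟩
  · rintro ⟨φ, hφ, rfl⟩
    obtain ⟨h1, h2⟩ := (isDualFeasible_symCertCone_iff_suN N β).1 hφ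
    exact ⟨φ, h1, h2, rfl⟩

/-- A dual-feasible functional for the reduced cone exists. -/
theorem exists_isDualFeasible_symCertCone_suN (n : ℕ) :
    ∃ φ : C(LGConfig d (Matrix.specialUnitaryGroup (Fin N) ℂ), ℝ) →ₗ[ℝ] ℝ,
      IsDualFeasible (symCertConeZdSuN (d := d) N β n) 1 φ := by
  obtain ⟨t, φ, hφ, hinv, -⟩ := symLevelValuesZd_nonempty (d := d) N β n 1
  exact ⟨φ, (isDualFeasible_symCertCone_iff_suN N β).2 ⟨hφ, hinv⟩⟩

/-! ### Soundness -/

/-- ★★ **A reduced certificate bounds every reduced-feasible value.** [folklore] -/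
theorem le_of_mem_symCertCone_suN {n : ℕ} {P : C(LGConfig d (Matrix.specialUnitaryGroup (Fin N) ℂ), ℝ)} {c : ℝ}
    (hc : c • (1 : C(LGConfig d (Matrix.specialUnitaryGroup (Fin N) ℂ), ℝ)) - P ∈ symCertConeZdSuN (d := d) N β n) :
    ∀ t ∈ symLevelValuesZdSuN (d := d) N β n P, t ≤ c := by
  rintro t ⟨φ, hφ, hinv, rfl⟩
  exact ((isDualFeasible_symCertCone_iff_suN N β).2 ⟨hφ, hinv⟩).le_of_mem_certLevels hc

/-- ★★ **A reduced certificate bounds every TRANSLATION-INVARIANT Gibbs state** (not necessarily the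
others). [folklore] -/
theorem invDlr_integral_le_of_mem_symCertCone_suN {n : ℕ}
    {P : C(LGConfig d (Matrix.specialUnitaryGroup (Fin N) ℂ), ℝ)} {c : ℝ}
    (hc : c • (1 : C(LGConfig d (Matrix.specialUnitaryGroup (Fin N) ℂ), ℝ)) - P ∈ symCertConeZdSuN (d := d) N β n)
    {μ : Measure (LGConfig d (Matrix.specialUnitaryGroup (Fin N) ℂ))}
    (hμ : μ ∈ ymGibbsMeasures (d := d) (fundamentalRep (Fin N)) β) (hT : IsZdTranslationInvariant μ) :
    ∫ U, P U ∂μ ≤ c :=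
  le_of_mem_symCertCone_suN N β hc _ (dlr_integral_mem_symLevelValuesZd N β n hμ hT P)

/-! ### Completeness at a fixed level -/

/-- ★★★ **No duality gap for the translation-reduced SDP on `ℤ^d`.** For `P` in the level-`n`
certificate domain: every reduced level-`n` value of `P` is `≤ c` iff `(c + ε) • 1 - P` has a
reduced certificate for every `ε > 0`. [folklore] -/
theorem forall_symLevelValuesZd_le_iff_suN {n : ℕ}
    {P : C(LGConfig d (Matrix.specialUnitaryGroup (Fin N) ℂ), ℝ)} (hP : P ∈ certDomainZdSuN (d := d) N β n)
    {c : ℝ} :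
    (∀ t ∈ symLevelValuesZdSuN (d := d) N β n P, t ≤ c) ↔
      ∀ ε : ℝ, 0 < ε → (c + ε) • (1 : C(LGConfig d (Matrix.specialUnitaryGroup (Fin N) ℂ), ℝ)) - P ∈
        symCertConeZdSuN (d := d) N β n := by
  have h := forall_apply_le_iff (certDomainZdSuN (d := d) N β n) (symCertCone_le_certDomain_suN N β n)
    (symCertCone_orderUnit_suN N β n).1 (symCertCone_orderUnit_suN N β n).2
    (exists_isDualFeasible_symCertCone_suN N β n) hP (c := c)
  rw [← h, symLevelValuesZd_eq_setOf_isDualFeasible_suN]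
  constructor
  · intro h' φ hφ
    exact h' _ ⟨φ, hφ, rfl⟩
  · rintro h' t ⟨φ, hφ, rfl⟩
    exact h' φ hφ

/-- ★★★ **Every constant strictly above the reduced level-`n` maximum has an explicit reduced
certificate**: `c' • 1 - P = σ + ρ + δ` with `σ` a sum of squares of level-`n` test functions,
`ρ` a combination of level-`n` row elements and `δ` a combination of translation differences of
words of length `≤ 2n`. [folklore] -/
theorem exists_symCertificate_suN {n : ℕ}
    {P : C(LGConfig d (Matrix.specialUnitaryGroup (Fin N) ℂ), ℝ)} (hP : P ∈ certDomainZdSuN (d := d) N β n)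
    {c c' : ℝ} (h : ∀ t ∈ symLevelValuesZdSuN (d := d) N β n P, t ≤ c) (hc : c < c') :
    ∃ σ ∈ sosCone (wordTruncation (ι := ZdEdge d) (fundamentalLatticeRep N) n),
      ∃ ρ ∈ rowSpace (fundamentalLatticeRep N) (suExp N)
        (fun e => wilsonBoundaryAction (fundamentalRep (Fin N)) {e}) β
        (wordTruncation (ι := ZdEdge d) (fundamentalLatticeRep N) n),
      ∃ δ ∈ translationDiffZdSuN (d := d) N n,
        σ + ρ + δ = c' • (1 : C(LGConfig d (Matrix.specialUnitaryGroup (Fin N) ℂ), ℝ)) - P := by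
  have h' := (forall_symLevelValuesZd_le_iff_suN N β hP).1 h (c' - c) (sub_pos.2 hc)
  rw [add_sub_cancel] at h'
  obtain ⟨y, hy, δ, hδ, hsum⟩ := Submodule.mem_sup.1 h'
  obtain ⟨σ, hσ, ρ, hρ, rfl⟩ := (mem_certCone_iff (fundamentalLatticeRep N)).1 hy
  rw [Submodule.restrictScalars_mem] at hδ
  exact ⟨σ, hσ, ρ, hρ, δ, hδ, hsum⟩

/-- ★★ **The reduced maximum equals the infimum of the reduced-certified constants.** [folklore] -/
theorem sSup_symLevelValuesZd_eq_sInf_suN {n : ℕ}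
    {P : C(LGConfig d (Matrix.specialUnitaryGroup (Fin N) ℂ), ℝ)} (hP : P ∈ certDomainZdSuN (d := d) N β n) :
    sSup (symLevelValuesZdSuN (d := d) N β n P) =
      sInf {c : ℝ | c • (1 : C(LGConfig d (Matrix.specialUnitaryGroup (Fin N) ℂ), ℝ)) - P ∈ symCertConeZdSuN (d := d) N β n} := by
  rw [symLevelValuesZd_eq_setOf_isDualFeasible_suN]
  exact sSup_eq_sInf (certDomainZdSuN (d := d) N β n) (symCertCone_le_certDomain_suN N β n)
    (symCertCone_orderUnit_suN N β n).1 (symCertCone_orderUnit_suN N β n).2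
    (exists_isDualFeasible_symCertCone_suN N β n) hP

/-! ### Completeness for the homogeneous phases -/

/-- ★★★ **Every polynomial bound strictly valid in all TRANSLATION-INVARIANT Gibbs states has a
reduced certificate at some level.** `SU(N)` on `ℤ^d`, any real `β`: if `∫ P dμ ≤ c₀` for every
translation-invariant DLR state `μ` and `c₀ < c`, then for some `n`,
`c • 1 - P ∈ symCertConeZdSuN N β n` (SOS + loop equations + translation multipliers). Plain
certificates prove exactly the bounds valid in ALL Gibbs states
(`exists_certificate_of_forall_dlr_le_suN`); reduced ones exactly those valid in the homogeneous
ones. [folklore] -/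
theorem exists_symCertificate_of_forall_invDlr_le_suN
    {P : C(LGConfig d (Matrix.specialUnitaryGroup (Fin N) ℂ), ℝ)}
    (hP : P ∈ polyAlgebra (ι := ZdEdge d) (fundamentalLatticeRep N)) {c₀ c : ℝ}
    (h : ∀ μ ∈ ymGibbsMeasures (d := d) (fundamentalRep (Fin N)) β, IsZdTranslationInvariant μ →
      ∫ U, P U ∂μ ≤ c₀) (hc : c₀ < c) :
    ∃ n, c • (1 : C(LGConfig d (Matrix.specialUnitaryGroup (Fin N) ℂ), ℝ)) - P ∈ symCertConeZdSuN (d := d) N β n := by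
  obtain ⟨hIne, hIbdd, -⟩ := invDlrValues_nonempty_bdd_suN (d := d) N β P
  have hS : sSup (invDlrValuesSuN (d := d) N β P) ≤ c₀ := by
    refine csSup_le hIne ?_
    rintro t ⟨μ, hμ, hT, rfl⟩
    exact h μ hμ hT
  have hlt : sSup (invDlrValuesSuN (d := d) N β P) < (c₀ + c) / 2 := by linarith
  have hev := (tendsto_sSup_symLevelValuesZd_suN N β hP).eventually (Iio_mem_nhds hlt)
  obtain ⟨n, hn₁, hn₂⟩ := (hev.and (eventually_mem_certDomainZd_suN N β hP)).exists
  obtain ⟨hbdd, -, -⟩ := bdd_symLevelValuesZd_suN N β hn₂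
  refine ⟨n, ?_⟩
  have hle : ∀ t ∈ symLevelValuesZdSuN (d := d) N β n P, t ≤ (c₀ + c) / 2 := fun t ht =>
    (le_csSup hbdd ht).trans (le_of_lt hn₁)
  have h' := (forall_symLevelValuesZd_le_iff_suN N β hn₂).1 hle (c - (c₀ + c) / 2) (by linarith)
  rwa [add_sub_cancel] at h'

end ZdSuN

end Summit.QuantumFields.GaugeBoot

end
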